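import Literature.Probability.Percolation.QuadCrossingQuadTopology
import Literature.Probability.Percolation.QuadCrossingContinuityReduction
import Literature.Probability.Percolation.QuadCrossingPathCrossings
import HarnessLib

/-!
# Sub-quads sharing three sides: local structure, and `⊞_Q ⊆ ⊞_{Q'}` in case (2) of Lemma 6.1

Topic `Probability/Percolation`; proofs file next to `QuadCrossingQuadTopology.lean` (boundary of a
quad = its four sides, crossing lemma, dual path) towards Schramm–Smirnov's continuity Lemma 6.1
(`SchrammSmirnov2011_lemma_6_1`, file `QuadCrossingContinuity.lean`; O. Schramm, S. Smirnov,
*On the scaling limits of planar percolation*, Ann. Probab. 39 (2011), arXiv:1101.5820, §6).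
Conditions (2) and (3) of that lemma compare a quad `Q` with a sub-quad `Q'`, `[Q'] ⊆ [Q]`,
sharing (parts of) three sides; the printed proof of case (2) opens with "clearly
`⊞_Q Δ ⊞_{Q'} = ⊞_{Q'} ∖ ⊞_Q`", i.e. every crossing of `Q` contains a crossing of `Q'`.  This file
proves that, for the crossings that matter (inside the drawn open edges of `δℤ²`, which are path
crossings by `joinedIn_inter_openEdgeUnion_of_isConnected`):

* `Quad.exists_ball_inter_carrier_subset` — **local structure at a shared side**: if
  `[Q'] ⊆ [Q]`, `∂₀Q' ⊆ ∂₀Q`, `∂₁Q' ⊆ ∂₁Q`, `∂₃Q' ⊆ ∂₃Q`, then near every point of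
  `∂₀Q' ∪ ∂₁Q' ∪ ∂₃Q'` off the free side `∂₂Q'` one has `B(p, r) ∩ [Q] ⊆ [Q']` (a connectedness
  argument in the straightened picture of `Q`);
* `Quad.carrier_inter_side_two_subset` — `[Q'] ∩ ∂₂Q ⊆ ∂₂Q'`;
* `Quad.exists_initial_segment` — a path in `[Q]` from `[Q']` to `∂₂Q` reaches `∂₂Q'` at a time up
  to which it stays in `[Q']` (first-exit argument);
* `Quad.exists_isCrossing_subquad_of_isCrossing` — hence, with `∂₀Q' = ∂₀Q`, every crossing of `Q`
  inside `openEdgeUnion δ ω` contains a crossing of `Q'` inside it (`⊞_Q ⊆ ⊞_{Q'}` for the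
  discrete configuration); and the trivial converse containment `Quad.IsCrossing.of_subquad` for
  the shape of condition (3) (`∂₀Q' ⊆ ∂₀Q`, `∂₂Q' ⊆ ∂₂Q`: `⊞_{Q'} ⊆ ⊞_Q`).

## References

* O. Schramm, S. Smirnov, Ann. Probab. 39 (2011) 1768–1814, arXiv:1101.5820, §6 Lemma 6.1,
  conditions (2)–(3) and the first line of the proof of case (2). [SchrammSmirnov2011]
-/

noncomputable section

open scoped unitInterval
open Set Filter Metric Function Complex
open _root_.Topology
open Literature.Topology.PlaneTopology

namespace Literature.Probability.Percolation

namespace QuadCrossing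

variable {D : Set ℂ}

namespace Quad

/-! ### Sub-quads sharing three sides (conditions (2)/(3) of Lemma 6.1): local structure -/

section Subquad

variable {Q Q' : Quad D}

/-- A side point is not an interior point of `[Q]`. [cite: SchrammSmirnov2011, §1.3] -/
theorem not_mem_interior_of_mem_side {Q : Quad D} {k : Fin 4} {p : ℂ} (hp : p ∈ Q.side k) :
    p ∉ interior Q.carrier :=
  (Q.side_subset_frontier k hp).2

/-- A point of `[Q]` off the interior lies on one of the four sides. [cite: SchrammSmirnov2011, §1.3] -/
theorem mem_sides_of_not_mem_interior {Q : Quad D} {p : ℂ} (hp : p ∈ Q.carrier)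
    (hpi : p ∉ interior Q.carrier) : p ∈ Q.side 0 ∪ Q.side 1 ∪ Q.side 2 ∪ Q.side 3 := by
  rw [← frontier_carrier, frontier, Q.isCompact_carrier.isClosed.closure_eq]
  exact ⟨hp, hpi⟩

/-- **Local structure of a sub-quad at a shared side.**  Let `[Q'] ⊆ [Q]` with
`∂₀Q' ⊆ ∂₀Q`, `∂₁Q' ⊆ ∂₁Q`, `∂₃Q' ⊆ ∂₃Q` (conditions (2)/(3) of Schramm–Smirnov's Lemma 6.1 are of
this shape).  Then at every point `p` of `∂₀Q' ∪ ∂₁Q' ∪ ∂₃Q'` off the free side `∂₂Q'`, the big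
quad is locally inside the small one: `B(p, r) ∩ [Q] ⊆ [Q']` for some `r > 0`.  (Straighten `Q` by
`H`; a small ball `B` around `H⁻¹ p` off `H⁻¹(∂₂Q')` gives the connected open set
`W = H(B ∩ (-1,1)²) ⊆ int[Q]`, which misses `∂[Q'] = ⋃ ∂ₖQ'` (three sides lie on `∂[Q]`, the
fourth is avoided), meets `int[Q']` (as `p ∈ [Q'] = cl int[Q']`), hence lies in `int[Q']`; and
`[Q] ∩ H(B) ⊆ cl W`.) [cite: SchrammSmirnov2011, Lemma 6.1 (2)-(3)] -/
theorem exists_ball_inter_carrier_subset (hcar : Q'.carrier ⊆ Q.carrier)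
    (h0 : Q'.side 0 ⊆ Q.side 0) (h1 : Q'.side 1 ⊆ Q.side 1) (h3 : Q'.side 3 ⊆ Q.side 3) {p : ℂ}
    (hp : p ∈ Q'.side 0 ∪ Q'.side 1 ∪ Q'.side 3) (hp2 : p ∉ Q'.side 2) :
    ∃ r > 0, ball p r ∩ Q.carrier ⊆ Q'.carrier := by
  obtain ⟨H, -, hcarH, -⟩ := Q.exists_straighten
  set S : Set ℂ := Icc (-1 : ℝ) 1 ×ℂ Icc (-1 : ℝ) 1 with hS
  have hintS : interior S = Ioo (-1 : ℝ) 1 ×ℂ Ioo (-1 : ℝ) 1 := by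
    rw [hS, interior_reProdIm, interior_Icc]
  have hclS : closure (interior S) = S := by
    rw [hintS, closure_reProdIm, closure_Ioo (by norm_num : (-1 : ℝ) ≠ 1)]
  have hintQ : interior Q.carrier = H '' interior S := by rw [hcarH, H.image_interior]
  -- `p ∈ [Q']`, and `p` lies on the boundary of `[Q]`
  have hpQ' : p ∈ Q'.carrier := by
    rcases hp with (hp | hp) | hp
    exacts [Q'.side_subset_carrier 0 hp, Q'.side_subset_carrier 1 hp, Q'.side_subset_carrier 3 hp]
  -- a ball around `H⁻¹ p` off the closed set `H⁻¹(∂₂Q')`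
  have hc' : IsClosed (H ⁻¹' Q'.side 2) := by
    have : IsCompact (Q'.side 2) := by
      rw [side_two_eq]
      exact (isClosed_eq continuous_fst continuous_const).isCompact.image Q'.continuous_toFun
    exact this.isClosed.preimage H.continuous
  obtain ⟨r, hr, hball⟩ : ∃ r > 0, ball (H.symm p) r ⊆ (H ⁻¹' Q'.side 2)ᶜ :=
    Metric.isOpen_iff.1 hc'.isOpen_compl (H.symm p) (by simpa using hp2)
  -- the connected open piece `W`
  set V : Set ℂ := interior S ∩ ball (H.symm p) r with hV
  set W : Set ℂ := H '' V with hW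
  have hVconv : Convex ℝ V := by
    rw [hV, hintS]
    refine Convex.inter ?_ (convex_ball _ _)
    rw [← (convex_Ioo (𝕜 := ℝ) (-1 : ℝ) 1).convexHull_eq, ← Complex.convexHull_reProdIm]
    exact convex_convexHull ℝ _
  have hWpre : IsPreconnected W := hVconv.isPreconnected.image _ H.continuous.continuousOn
  have hWint : W ⊆ interior Q.carrier := by
    rw [hintQ]
    exact image_mono inter_subset_left
  -- `W` misses the boundary of `[Q']`
  have hWfr : ∀ w ∈ W, w ∉ frontier Q'.carrier := by
    intro w hw hwfr
    rw [frontier_carrier] at hwfr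
    have hwi : w ∈ interior Q.carrier := hWint hw
    rcases hwfr with ((hw0 | hw1) | hw2) | hw3
    · exact not_mem_interior_of_mem_side (h0 hw0) hwi
    · exact not_mem_interior_of_mem_side (h1 hw1) hwi
    · obtain ⟨v, hv, rfl⟩ := hw
      exact hball hv.2 hw2
    · exact not_mem_interior_of_mem_side (h3 hw3) hwi
  -- hence `W ⊆ int[Q']` or `W ⊆ [Q']ᶜ`
  have hWsub : W ⊆ interior Q'.carrier ∪ Q'.carrierᶜ := fun w hw => by
    by_cases hwQ' : w ∈ Q'.carrier
    · left
      by_contra hwi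
      exact hWfr w hw (by
        rw [frontier, Q'.isCompact_carrier.isClosed.closure_eq]
        exact ⟨hwQ', hwi⟩)
    · exact Or.inr hwQ'
  have hdisj : Disjoint (interior Q'.carrier) Q'.carrierᶜ :=
    disjoint_compl_right.mono_left interior_subset
  have hWor := hWpre.subset_or_subset isOpen_interior Q'.isCompact_carrier.isClosed.isOpen_compl
    hdisj hWsub
  -- `W` meets `int[Q']`
  have hWmeet : (W ∩ interior Q'.carrier).Nonempty := by
    have hpcl : p ∈ closure (interior Q'.carrier) := by
      rw [closure_interior_carrier]; exact hpQ'
    have hN : H '' ball (H.symm p) r ∈ 𝓝 p := by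
      refine (H.isOpenMap _ isOpen_ball).mem_nhds ⟨H.symm p, mem_ball_self hr, ?_⟩
      exact H.apply_symm_apply p
    obtain ⟨w, hwN, hwi⟩ := mem_closure_iff_nhds.1 hpcl _ hN
    obtain ⟨v, hv, rfl⟩ := hwN
    refine ⟨H v, ⟨v, ⟨?_, hv⟩, rfl⟩, hwi⟩
    have : H v ∈ interior Q.carrier := interior_mono hcar hwi
    rw [hintQ] at this
    obtain ⟨v', hv', hvv'⟩ := this
    rwa [← H.injective hvv']
  have hWQ' : W ⊆ interior Q'.carrier := by
    rcases hWor with h | h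
    · exact h
    · obtain ⟨w, hwW, hwi⟩ := hWmeet
      exact absurd (interior_subset hwi) (h hwW)
  -- conclusion on the open neighbourhood `H(B)` of `p`, then on a ball
  have hN : IsOpen (H '' ball (H.symm p) r) := H.isOpenMap _ isOpen_ball
  have hpN : p ∈ H '' ball (H.symm p) r := ⟨H.symm p, mem_ball_self hr, H.apply_symm_apply p⟩
  obtain ⟨r', hr', hball'⟩ := Metric.isOpen_iff.1 hN p hpN
  refine ⟨r', hr', fun z ⟨hz, hzQ⟩ => ?_⟩
  obtain ⟨v, hv, rfl⟩ := hball' hz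
  have hvS : v ∈ S := by
    rw [hcarH] at hzQ
    obtain ⟨v', hv', hvv'⟩ := hzQ
    rwa [← H.injective hvv']
  have hvcl : v ∈ closure V := by
    rw [hV, inter_comm]
    apply isOpen_ball.inter_closure
    exact ⟨hv, hclS.symm ▸ hvS⟩
  have : H v ∈ closure W := by
    rw [hW, ← H.image_closure]
    exact mem_image_of_mem H hvcl
  rw [← closure_interior_carrier]
  exact closure_mono hWQ' this

/-- **The free side catches the shared corner region**: under the same hypotheses,
`[Q'] ∩ ∂₂Q ⊆ ∂₂Q'` — a point of the small quad on the far side of the big one lies on the free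
side of the small one.  (Such a point is on `∂[Q']` but not interior; if it were on a shared side
it would be a corner `Q(1,0)` or `Q(1,1)` of `Q`, near which the points `Q(1,t)`, `0 < t < 1`,
of `∂₂Q` lie in `[Q']` by the local lemma, on no shared side, hence on the closed set `∂₂Q'`.)
[cite: SchrammSmirnov2011, Lemma 6.1 (2)-(3)] -/
theorem carrier_inter_side_two_subset (hcar : Q'.carrier ⊆ Q.carrier)
    (h0 : Q'.side 0 ⊆ Q.side 0) (h1 : Q'.side 1 ⊆ Q.side 1) (h3 : Q'.side 3 ⊆ Q.side 3) :
    Q'.carrier ∩ Q.side 2 ⊆ Q'.side 2 := by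
  -- points `Q(1,t)`, `0 < t < 1`, of `∂₂Q` lying in `[Q']` are on `∂₂Q'`
  have hmid : ∀ t : I, 0 < (t : ℝ) → (t : ℝ) < 1 → Q (1, t) ∈ Q'.carrier → Q (1, t) ∈ Q'.side 2 := by
    intro t ht0 ht1 htQ'
    have h2 : Q (1, t) ∈ Q.side 2 := ⟨(1, t), rfl, rfl⟩
    have hni : Q (1, t) ∉ interior Q'.carrier := fun h =>
      not_mem_interior_of_mem_side h2 (interior_mono hcar h)
    rcases mem_sides_of_not_mem_interior htQ' hni with ((hs0 | hs1) | hs2) | hs3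
    · exact absurd (h0 hs0) (Set.disjoint_right.1 (Q.disjoint_side_side_add_two 0) h2)
    · obtain ⟨q, hq, hqe⟩ := (show Q (1, t) ∈ Q '' {z : I × I | z.2 = 0} from h1 hs1)
      have := Q.injective_toFun hqe
      rw [this] at hq
      simp only [mem_setOf_eq] at hq
      exact absurd (congrArg Subtype.val hq) ht0.ne'
    · exact hs2
    · obtain ⟨q, hq, hqe⟩ := (show Q (1, t) ∈ Q '' {z : I × I | z.2 = 1} from h3 hs3)
      have := Q.injective_toFun hqe
      rw [this] at hq
      simp only [mem_setOf_eq] at hq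
      exact absurd (congrArg Subtype.val hq) ht1.ne
  rintro z ⟨hzQ', hz2⟩
  by_contra hz
  have hni : z ∉ interior Q'.carrier := fun h => not_mem_interior_of_mem_side hz2 (interior_mono hcar h)
  have hsides := mem_sides_of_not_mem_interior hzQ' hni
  have hp : z ∈ Q'.side 0 ∪ Q'.side 1 ∪ Q'.side 3 := by
    rcases hsides with ((hs | hs) | hs) | hs
    · exact Or.inl (Or.inl hs)
    · exact Or.inl (Or.inr hs)
    · exact absurd hs hz
    · exact Or.inr hs
  obtain ⟨r, hr, hloc⟩ := exists_ball_inter_carrier_subset hcar h0 h1 h3 hp hz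
  -- `z = Q(1, t₀)`; the curve `t ↦ Q(1, t)` through `z`
  obtain ⟨⟨s, t₀⟩, hst, rfl⟩ := (show z ∈ Q '' {z : I × I | z.1 = 1} from hz2)
  simp only [mem_setOf_eq] at hst
  subst hst
  set f : ℝ → ℂ := fun u => Q (1, projIcc 0 1 zero_le_one u) with hf
  have hfc : Continuous f :=
    Q.continuous_toFun.comp (continuous_const.prodMk continuous_projIcc)
  have hft₀ : f t₀ = Q (1, t₀) := by simp [hf, projIcc_val]
  -- `Q(1,t₀)` is in the closure of `f((0,1)) ∩ B(z, r)`, which lies in the closed set `∂₂Q'`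
  have hcl : Q (1, t₀) ∈ closure (f '' Ioo 0 1) := by
    have : (t₀ : ℝ) ∈ closure (Ioo (0 : ℝ) 1) := by
      rw [closure_Ioo zero_ne_one]; exact t₀.2
    rw [← hft₀]
    exact image_closure_subset_closure_image hfc ⟨(t₀ : ℝ), this, rfl⟩
  have hcl' : Q (1, t₀) ∈ closure (ball (Q (1, t₀)) r ∩ f '' Ioo 0 1) :=
    isOpen_ball.inter_closure ⟨mem_ball_self hr, hcl⟩
  have hsub : ball (Q (1, t₀)) r ∩ f '' Ioo 0 1 ⊆ Q'.side 2 := by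
    rintro _ ⟨hwb, u, hu, rfl⟩
    have hu' : projIcc 0 1 zero_le_one u = ⟨u, Ioo_subset_Icc_self hu⟩ := projIcc_of_mem _ (Ioo_subset_Icc_self hu)
    have hwQ : f u ∈ Q.carrier := ⟨_, rfl⟩
    have hwQ' : f u ∈ Q'.carrier := hloc ⟨hwb, hwQ⟩
    simp only [hf, hu'] at hwQ' ⊢
    exact hmid ⟨u, _⟩ hu.1 hu.2 hwQ'
  have hclosed : IsClosed (Q'.side 2) := by
    rw [side_two_eq]
    exact ((isClosed_eq continuous_fst continuous_const).isCompact.image Q'.continuous_toFun).isClosed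
  exact hz (hclosed.closure_subset_iff.2 hsub hcl')

/-- **Initial segments of crossings.**  Let `[Q'] ⊆ [Q]` with `∂₀Q' ⊆ ∂₀Q`, `∂₁Q' ⊆ ∂₁Q`,
`∂₃Q' ⊆ ∂₃Q`, and let `β` be a path in `[Q]` starting in `[Q']` and ending on `∂₂Q`.  Then `β`
reaches the free side `∂₂Q'` at a time `τ` up to which it stays inside `[Q']` ("clearly
`⊞_Q Δ ⊞_{Q'} = ⊞_{Q'} ∖ ⊞_Q`" in case (2) of Schramm–Smirnov's Lemma 6.1: every crossing of
`Q` contains a crossing of `Q'`).  Proof: the first exit time `τ` of `[Q']` has `β τ ∈ ∂[Q']`; an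
exit through a shared side is impossible by the local lemma, so `β τ ∈ ∂₂Q'`; if `β` never exits,
`β 1 ∈ [Q'] ∩ ∂₂Q ⊆ ∂₂Q'`. [cite: SchrammSmirnov2011, proof of Lemma 6.1, case (2)] -/
theorem exists_initial_segment (hcar : Q'.carrier ⊆ Q.carrier) (h0 : Q'.side 0 ⊆ Q.side 0)
    (h1 : Q'.side 1 ⊆ Q.side 1) (h3 : Q'.side 3 ⊆ Q.side 3) {β : ℝ → ℂ}
    (hβ : ContinuousOn β (Icc 0 1)) (hβQ : MapsTo β (Icc 0 1) Q.carrier)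
    (hβ0 : β 0 ∈ Q'.carrier) (hβ1 : β 1 ∈ Q.side 2) :
    ∃ τ ∈ Icc (0 : ℝ) 1, β τ ∈ Q'.side 2 ∧ MapsTo β (Icc 0 τ) Q'.carrier := by
  set T : Set ℝ := {t | t ∈ Icc (0 : ℝ) 1 ∧ β t ∉ Q'.carrier} with hT
  by_cases hTe : T = ∅
  · -- `β` stays in `[Q']`
    have hall : ∀ t ∈ Icc (0 : ℝ) 1, β t ∈ Q'.carrier := fun t ht => by
      by_contra h
      have : t ∈ T := ⟨ht, h⟩
      rw [hTe] at this
      exact this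
    exact ⟨1, right_mem_Icc.2 zero_le_one,
      carrier_inter_side_two_subset hcar h0 h1 h3 ⟨hall 1 (right_mem_Icc.2 zero_le_one), hβ1⟩,
      fun t ht => hall t ht⟩
  · have hTne : T.Nonempty := nonempty_iff_ne_empty.2 hTe
    have hTbdd : BddBelow T := ⟨0, fun t ht => ht.1.1⟩
    set τ := sInf T with hτ
    have hτ0 : 0 ≤ τ := le_csInf hTne fun t ht => ht.1.1
    have hτ1 : τ ≤ 1 := by
      obtain ⟨t, ht⟩ := hTne
      exact (csInf_le hTbdd ht).trans ht.1.2
    have hτI : τ ∈ Icc (0 : ℝ) 1 := ⟨hτ0, hτ1⟩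
    -- before `τ`, the path is in `[Q']`
    have hbefore : ∀ t ∈ Ico (0 : ℝ) τ, β t ∈ Q'.carrier := fun t ht => by
      by_contra h
      have : t ∈ T := ⟨⟨ht.1, ht.2.le.trans hτ1⟩, h⟩
      exact (lt_irrefl _ (ht.2.trans_le (csInf_le hTbdd this)))
    -- and at `τ`
    have hclosedT' : IsClosed {t | t ∈ Icc (0 : ℝ) 1 ∧ β t ∈ Q'.carrier} := by
      exact hβ.preimage_isClosed_of_isClosed isClosed_Icc Q'.isCompact_carrier.isClosed
    have hβτ : β τ ∈ Q'.carrier := by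
      rcases hτ0.eq_or_lt with h | h
      · rw [← h]; exact hβ0
      · have hτcl : τ ∈ closure (Ico (0 : ℝ) τ) := by
          rw [closure_Ico h.ne]; exact right_mem_Icc.2 h.le
        have hsub : Ico (0 : ℝ) τ ⊆ {t | t ∈ Icc (0 : ℝ) 1 ∧ β t ∈ Q'.carrier} := fun t ht =>
          ⟨⟨ht.1, ht.2.le.trans hτ1⟩, hbefore t ht⟩
        exact (hclosedT'.closure_subset_iff.2 hsub hτcl).2
    have hτT : τ ∉ T := fun h => h.2 hβτ
    -- `β τ` is in the closure of the exterior of `[Q']`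
    have hcont : ContinuousWithinAt β (Icc 0 1) τ := hβ τ hτI
    have hfr : β τ ∈ frontier Q'.carrier := by
      rw [frontier, Q'.isCompact_carrier.isClosed.closure_eq]
      refine ⟨hβτ, fun hint => ?_⟩
      -- points of `T` just above `τ` map outside `[Q']`, contradicting openness of the interior
      have hmem : β ⁻¹' interior Q'.carrier ∈ 𝓝[Icc 0 1] τ :=
        hcont (isOpen_interior.mem_nhds hint)
      obtain ⟨ε, hε, hεsub⟩ := Metric.mem_nhdsWithin_iff.1 hmem
      obtain ⟨t, htT, htε⟩ := exists_lt_of_csInf_lt hTne (lt_add_of_pos_right τ hε)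
      have hτt : τ ≤ t := csInf_le hTbdd htT
      have : t ∈ ball τ ε ∩ Icc 0 1 := ⟨by
        rw [mem_ball, Real.dist_eq, abs_of_nonneg (sub_nonneg.2 hτt)]; linarith, htT.1⟩
      exact htT.2 (interior_subset (hεsub this))
    rw [frontier_carrier] at hfr
    by_cases h2 : β τ ∈ Q'.side 2
    · exact ⟨τ, hτI, h2, fun t ht => by
        rcases ht.2.eq_or_lt with h | h
        · rw [h]; exact hβτ
        · exact hbefore t ⟨ht.1, h⟩⟩
    · -- exit through a shared side is impossible
      exfalso
      have hp : β τ ∈ Q'.side 0 ∪ Q'.side 1 ∪ Q'.side 3 := by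
        rcases hfr with ((hs | hs) | hs) | hs
        · exact Or.inl (Or.inl hs)
        · exact Or.inl (Or.inr hs)
        · exact absurd hs h2
        · exact Or.inr hs
      obtain ⟨r, hr, hloc⟩ := exists_ball_inter_carrier_subset hcar h0 h1 h3 hp h2
      have hmem : β ⁻¹' ball (β τ) r ∈ 𝓝[Icc 0 1] τ := hcont (ball_mem_nhds _ hr)
      obtain ⟨ε, hε, hεsub⟩ := Metric.mem_nhdsWithin_iff.1 hmem
      obtain ⟨t, htT, htε⟩ := exists_lt_of_csInf_lt hTne (lt_add_of_pos_right τ hε)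
      have hτt : τ ≤ t := csInf_le hTbdd htT
      have htball : t ∈ ball τ ε ∩ Icc 0 1 := ⟨by
        rw [mem_ball, Real.dist_eq, abs_of_nonneg (sub_nonneg.2 hτt)]; linarith, htT.1⟩
      exact htT.2 (hloc ⟨hεsub htball, hβQ htT.1⟩)

/-- **Every crossing of `Q` contains a crossing of `Q'`** — `Q' ≤ Q` in Schramm–Smirnov's order —
when `[Q'] ⊆ [Q]`, `∂₀Q' = ∂₀Q`, `∂₁Q' ⊆ ∂₁Q`, `∂₃Q' ⊆ ∂₃Q` (the containments of condition (2) of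
Lemma 6.1), for crossings inside the drawn open edges of `δℤ²` (`δ > 0`; these crossings are path
crossings, `joinedIn_inter_openEdgeUnion_of_isConnected`, and one takes the initial segment of the
path up to the free side).  Hence `⊞_Q ⊆ ⊞_{Q'}` for the discrete configuration.
[cite: SchrammSmirnov2011, proof of Lemma 6.1, case (2)] -/
theorem exists_isCrossing_subquad_of_isCrossing (hcar : Q'.carrier ⊆ Q.carrier)
    (h0 : Q'.side 0 = Q.side 0) (h1 : Q'.side 1 ⊆ Q.side 1) (h3 : Q'.side 3 ⊆ Q.side 3)
    {δ : ℝ} (hδ : 0 < δ) {ω : BondConfig (LatticeModels.Site 2)} {K : Set ℂ}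
    (hK : Q.IsCrossing K) (hKO : K ⊆ openEdgeUnion δ ω) :
    ∃ K', Q'.IsCrossing K' ∧ K' ⊆ openEdgeUnion δ ω := by
  obtain ⟨hKc, hKconn, hKsub, ⟨a, haK, ha0⟩, ⟨b, hbK, hb2⟩⟩ := hK
  obtain ⟨γ, hγ⟩ := joinedIn_inter_openEdgeUnion_of_isConnected hδ hKc hKconn hKO hKsub haK hbK
  -- the extended path `β = γ.extend : ℝ → ℂ`
  have hβc : Continuous γ.extend := γ.continuous_extend
  have hβmem : ∀ t, γ.extend t ∈ Q.carrier ∩ openEdgeUnion δ ω := fun t =>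
    hγ (projIcc 0 1 zero_le_one t)
  have ha' : a ∈ Q'.carrier := by
    have : a ∈ Q'.side 0 := h0.symm ▸ ha0
    exact Q'.side_subset_carrier 0 this
  obtain ⟨τ, hτ, hτ2, hτsub⟩ := exists_initial_segment hcar h0.le h1 h3 hβc.continuousOn
    (fun t _ => (hβmem t).1) (by rw [γ.extend_zero]; exact ha') (by rw [γ.extend_one]; exact hb2)
  refine ⟨γ.extend '' Icc 0 τ, ⟨isCompact_Icc.image hβc,
    (isConnected_Icc hτ.1).image _ hβc.continuousOn, fun _ ⟨t, ht, hte⟩ => hte ▸ hτsub ht,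
    ⟨a, ⟨0, left_mem_Icc.2 hτ.1, γ.extend_zero⟩, h0.symm ▸ ha0⟩,
    ⟨γ.extend τ, ⟨τ, right_mem_Icc.2 hτ.1, rfl⟩, hτ2⟩⟩, ?_⟩
  rintro _ ⟨t, -, rfl⟩
  exact (hβmem t).2

/-- Conversely, when `[Q'] ⊆ [Q]`, `∂₀Q' ⊆ ∂₀Q` and `∂₂Q' ⊆ ∂₂Q` (the containments of condition
(3) of Lemma 6.1), **every crossing of `Q'` is a crossing of `Q`**, so `⊞_{Q'} ⊆ ⊞_Q`.
[cite: SchrammSmirnov2011, proof of Lemma 6.1, case (3)] -/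
theorem IsCrossing.of_subquad (hcar : Q'.carrier ⊆ Q.carrier) (h0 : Q'.side 0 ⊆ Q.side 0)
    (h2 : Q'.side 2 ⊆ Q.side 2) {K : Set ℂ} (hK : Q'.IsCrossing K) : Q.IsCrossing K :=
  ⟨hK.1, hK.2.1, hK.2.2.1.trans hcar, hK.2.2.2.1.mono (inter_subset_inter_right _ h0),
    hK.2.2.2.2.mono (inter_subset_inter_right _ h2)⟩

end Subquad

end Quad

end QuadCrossing

end Literature.Probability.Percolation
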